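import Summits.Langlands.Langlands.Statement
import Literature.NumberTheory.Automorphic.IsAutomorphicAE
import HarnessLib

/-!
# On-path lemma (F4) for the rung `RealQuadraticBaseChangeGL2 = NonsolvableBaseChangeGL2 2` of line
# `RealQuadraticBaseChangeGL2` (crux `ReciprocityUpToIrreducibility`, item stmt-Langlands-14328; g16)

`Langlands → NonsolvableBaseChangeGL2 d₀` for EVERY bottom degree `d₀` (in particular the rung `d₀ = 2` and every
higher rung): clause (B) of the summit over the TOP field `F` at any reciprocity datum — one exists by the `Nonempty`
conjunct of the Statement — applies to the restricted representation `ρ₀|Γ_F = ρ₀.restrictField F`, because the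
family's de Rham clause is stated against the PINNED Fontaine datum `fontainePstAdicCompletion w ℓ hw`, which is
`Rec.pst ℓ w hw` by definition (`ReciprocityData.pst`), so the family's hypotheses give `IsGeometricFramed Rec (ρ₀|Γ_F)`
on the nose, and `Corresponds Rec ι π ρ` contains `SatakeFrobCompatibleAE ι π ρ` as its first conjunct.
Sorry-free; imports only the Statement and `IsAutomorphicAE`.  The rung is a CONSEQUENCE of `S` — fine BECAUSE the
F3 witness (`_special`: `floor_one` from the in-tree named fact `Dieulefait2015_baseChange_GL2`) pins the other end of
the ladder to a proved floor (the [nec]-trap guard of lens 3.10 is discharged by the witness).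
-/

noncomputable section

set_option linter.dupNamespace false

open scoped MatrixGroups Matrix NumberField Classical Polynomial
open Filter IsDedekindDomain Field Polynomial NumberField
open Literature.NumberTheory.Automorphic Literature.NumberTheory.GaloisRepresentations
open Literature.NumberTheory.PAdicHodge
open Summit.Langlands

namespace Summit.Langlands.Langlands.Cruxes.ReciprocityUpToIrreducibility.RealQuadraticBaseChangeGL2


/-- **The RUNG FAMILY, dial = degree `d₀` of the totally real bottom field** (verbatim as in `_onpath` / `_special`):
non-solvable base change for `GL₂` from totally real fields `F₀` of degree `d₀` — for every cuspidal `π₀` of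
`GL₂(𝔸_{F₀})` with a REGULAR `L`-algebraic infinity type, every `ι`, every framed `ρ₀` attached to `π₀` at almost
all places and every totally real extension `F ⊇ F₀` (any `F₀`-algebra structure; no solvability): if `ρ₀|Γ_F` is
irreducible, a.e. unramified and de Rham above `ℓ` for Fontaine's pinned datum, it is automorphic (`IsAutomorphicAE`). -/
def NonsolvableBaseChangeGL2 (d₀ : ℕ) : Prop :=
  ∀ (F₀ : Type) [Field F₀] [NumberField F₀] [IsTotallyReal F₀], Module.finrank ℚ F₀ = d₀ →
    ∀ (hcpt₀ : isCompact_glFiniteIntegralLevel 2 F₀) (π₀ : CuspidalAutomorphicRepData 2 F₀ hcpt₀),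
      (∃ T : InfinityType F₀ 2, π₀.1.HasInfinityType T ∧ T.IsRegular ∧ T.IsLAlgebraic) →
      ∀ (ℓ : ℕ) [Fact ℓ.Prime] (ι : PadicAlgCl ℓ ≃+* ℂ) (ρ₀ : FramedGaloisRep F₀ (PadicAlgCl ℓ) 2),
        SatakeFrobCompatibleAE ι π₀.1 ρ₀ →
        ∀ (F : Type) [Field F] [NumberField F] [Algebra F₀ F] [IsTotallyReal F],
          (ρ₀.restrictField F).toGaloisRep.IsIrreducible →
          (∀ᶠ w : HeightOneSpectrum (𝓞 F) in cofinite, (ρ₀.restrictField F).IsUnramifiedAt w) →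
          (∀ (w : HeightOneSpectrum (𝓞 F)) (hw : ((ℓ : ℕ) : 𝓞 F) ∈ w.asIdeal),
              (fontainePstAdicCompletion w ℓ hw).IsDeRhamFramed ((ρ₀.restrictField F).toLocal w)) →
          ∀ (hcpt : isCompact_glFiniteIntegralLevel 2 F), IsAutomorphicAE ι hcpt (ρ₀.restrictField F)

/-- **THE RUNG (θ19 = 2)**: non-solvable base change for `GL₂` from REAL QUADRATIC bottom fields. -/
def RealQuadraticBaseChangeGL2 : Prop := NonsolvableBaseChangeGL2 2


/-! ## The on-path lemmas (sorry-free) -/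

/-- **F4, every degree**: `Langlands → NonsolvableBaseChangeGL2 d₀`. -/
theorem nonsolvableBaseChangeGL2_of_langlands (d₀ : ℕ) (hL : _root_.Langlands) :
    NonsolvableBaseChangeGL2 d₀ := by
  intro F₀ _ _ _ _hd hcpt₀ π₀ _hreg ℓ _ ι ρ₀ _hcomp F _ _ _ _ hirr hunr hdR hcpt
  obtain ⟨⟨Rec⟩, hall⟩ := hL F
  have hB : GaloisToAutomorphic 2 Rec hcpt := (hall Rec 2 (by norm_num) hcpt).2
  have hgeo : IsGeometricFramed Rec (ρ₀.restrictField F) := ⟨hunr, fun w hw => hdR w hw⟩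
  obtain ⟨π, hLalg, hcorr⟩ := hB ℓ ι (ρ₀.restrictField F) hirr hgeo
  exact ⟨π, hLalg, hcorr.1⟩

/-- **F4 on-path lemma for the rung**: `Langlands → RealQuadraticBaseChangeGL2`. -/
@[aesop safe apply]
theorem RealQuadraticBaseChangeGL2_of_Langlands (hL : _root_.Langlands) : RealQuadraticBaseChangeGL2 :=
  nonsolvableBaseChangeGL2_of_langlands 2 hL

/-- Dial monotonicity is NOT claimed (the degrees index disjoint classes of bottom fields); instead every member is
on-path individually (`nonsolvableBaseChangeGL2_of_langlands d₀`). The degree-zero member is vacuous: -/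
theorem family_zero : NonsolvableBaseChangeGL2 0 := by
  intro F₀ _ _ _ hd
  exact absurd hd (Module.finrank_pos (R := ℚ) (M := F₀)).ne'

end Summit.Langlands.Langlands.Cruxes.ReciprocityUpToIrreducibility.RealQuadraticBaseChangeGL2

end
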